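import Summits.AtomisticToContinuum.BoseEinsteinCondensation.Theorems.BECInsertionCorrectorCorrectorClosureHoleModeReduction
import Summits.AtomisticToContinuum.BoseEinsteinCondensation.Theorems.BECInsertionCorrectorCorrectorClosureGroundStateFrame
import Summits.AtomisticToContinuum.BoseEinsteinCondensation.Theorems.BECHusimiAmplitudeGasPositivityReductionStability
import Literature.MathematicalPhysics.QuantumManyBody.PeriodicBoseGasTagged
import HarnessLib

/-!
# Crux `CorrectorClosure` (stmt-AtomisticToContinuum-12058), line `insertion-mode-gaussian-domination` —
# the torus-BEC body of item 8997 for BOUNDED potentials from remainder domination, near-convexity and K1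

Supports (does not close) stmt-AtomisticToContinuum-12058, route `BECInsertionCorrector`.

`periodicBEC_bounded_of_remainderDomination`: REMAINDER DOMINATION (the heart S3 of the line, verbatim, as a
hypothesis) ∧ NEAR-CONVEXITY (the body of item 9094 at `ε = 1` for every admissible `v`, as a hypothesis) ∧
K1 = `StaticResponseBound` give, for every BOUNDED repulsive finite-range `v`, the body of `PeriodicBEC`
(item 8997, the hypothesis of `BoundaryTransferWeak`): there is `ρ₀ > 0` such that for `0 < ρ < ρ₀` there is
`c > 0` with, for all large particle numbers `M`, some `δ > 0` such that every `δ`-near-minimiser `Ψ` of the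
periodic `M`-body energy in the box `sideLength ρ M` has `condensateOccupation ≥ c · M`.

Proof (pure logic over landed theorems). The zero-mode floor of the TRUE `(N+1)`-body torus Feynman–Kac
ground state `Φ₀`, `f₀(Φ₀) = n₀/(N+1) ≥ c₁` at `L = sideLength ρ (N+1)` for all large `N`
(`f0Floor_of_remainderDomination`, p144723), read through `(N+1) f₀ = n₀`
(`succ_mul_taggedZeroModeOccupation`) is `n₀(Φ₀) ≥ c₁ (N+1)`; the ground-state frame (`groundStateFrame`)
supplies `Φ₀` as a periodic trial state attaining `E₀(N+1, L)`; the two-sided stability of the condensate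
occupation between `δ`-near-minimisers for bounded `v` (`condensateOccupation_le_of_nearMinimisers`, at
`ε = c₁/2`) transfers the floor to every `δ`-near-minimiser with loss `c₁(N+1)/2`; finally the index shift
`M = N + 1` (eventually in `N` ⇒ eventually in `M`). No insertion residue, no removal fidelity, no
unbounded-case stub is used. No new definitions.
-/

noncomputable section

open MeasureTheory Filter
open scoped ENNReal NNReal BigOperators ComplexConjugate

namespace Summit.AtomisticToContinuum.BoseEinsteinCondensation.Theorems.CorrectorClosure.InsertionModeGaussianDomination

open Literature.MathematicalPhysics.QuantumManyBody.BoseGas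
open Summit.AtomisticToContinuum.BoseEinsteinCondensation.Theses.BECInsertionCorrector
open Summit.AtomisticToContinuum.BoseEinsteinCondensation.Theorems.CorrectorClosure.Negative
  (sideLength_succ_pos)
open Summit.AtomisticToContinuum.BoseEinsteinCondensation.Theorems.CorrectorClosure.GeometricMeanCorrector
  (groundStateFrame)
open Summit.AtomisticToContinuum.BoseEinsteinCondensation.Theorems
  (condensateOccupation_le_of_nearMinimisers)

/-- **Index shift for eventual statements on `ℕ`**: if `P (N+1)` holds for all large `N`, then `P M` holds
for all large `M`. [folklore] -/
theorem eventually_atTop_of_eventually_succ {P : ℕ → Prop} (h : ∀ᶠ N : ℕ in atTop, P (N + 1)) :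
    ∀ᶠ M : ℕ in atTop, P M := by
  obtain ⟨N₀, hN₀⟩ := Filter.eventually_atTop.1 h
  refine Filter.eventually_atTop.2 ⟨N₀ + 1, fun M hM => ?_⟩
  obtain ⟨K, rfl⟩ : ∃ K, M = K + 1 := ⟨M - 1, by omega⟩
  exact hN₀ K (by omega)

/-- **`PeriodicBEC` for bounded potentials from remainder domination, near-convexity and K1.** For every
bounded repulsive finite-range `v`: remainder domination (S3, hypothesis `hR`, verbatim), near-convexity of
the periodic ground-state energy in `N` (the body of item 9094 for every admissible `v`, hypothesis
`hconvAll`) and K1 (`StaticResponseBound`) give `ρ₀ > 0` such that for `0 < ρ < ρ₀` there is `c > 0` with: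
for all large `M` there is `δ > 0` such that every periodic trial state `Ψ` of `M` bosons in the box
`sideLength ρ M` with `periodicEnergy v Ψ ≤ E₀ + δ` has `ofReal (c M) ≤ condensateOccupation M L Ψ`.
Floor on the exact FK ground state (`f0Floor_of_remainderDomination`) + `(N+1) f₀ = n₀` + stability of `n₀`
between near-minimisers (`condensateOccupation_le_of_nearMinimisers`) + the shift `M = N+1`. [folklore] -/
theorem periodicBEC_bounded_of_remainderDomination
    (hR : ∀ (v : ℝ → ℝ≥0∞), IsRepulsiveFiniteRange v → (∃ C : ℝ≥0, ∀ r, v r ≤ C) → ∀ (B₁ : ℝ), 0 <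
      B₁ → ∀ (M₀ : ℝ), 0 < M₀ → ∃ B : ℝ, 0 < B ∧ ∃ ρ₃ : ℝ, 0 < ρ₃ ∧ ∀ ρ : ℝ, 0 < ρ → ρ < ρ₃ → ∀ᶠ N :
      ℕ in atTop, ∀ (L : ℝ), L = sideLength ρ (N + 1) → (∃ C : ℝ≥0, ∀ x, periodizedPotential v L x ≤
      C) → ∀ (Θ₀ : Config N → ℝ), IsPeriodicGroundStateFK v L Θ₀ → Continuous Θ₀ → (∀ X, 0 < Θ₀ X) →
      ∀ (Φ₀ : Config (N + 1) → ℝ), IsPeriodicGroundStateFK v L Φ₀ → Continuous Φ₀ → (∀ X, 0 < Φ₀ X)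
      → ∀ (n : Fin 3 → ℤ), n ≠ 0 → ‖latticeVec (2 * Real.pi / L) n‖ ^ 2 ≤ M₀ ^ 2 * ρ *
      (scatteringLength v).toReal → hMinusOneSqW L Θ₀ (fun X => ∑ j, Real.cos (2 * Real.pi / L * ∑
      i, (n i : ℝ) * X j i)) + hMinusOneSqW L Θ₀ (fun X => ∑ j, Real.sin (2 * Real.pi / L * ∑ i, (n
      i : ℝ) * X j i)) ≤ ENNReal.ofReal (B₁ * N / max ((N : ℝ) / L ^ 3 * (scatteringLength
      v).toReal) ((2 * Real.pi / L) ^ 2 * ∑ i, (n i : ℝ) ^ 2)) → hMinusOneSqW L Θ₀ (fun Y => (modeAn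
      L (planeWaveMode L n) (fun X => (Φ₀ X : ℂ)) Y).re / Θ₀ Y) + hMinusOneSqW L Θ₀ (fun Y =>
      (modeAn L (planeWaveMode L n) (fun X => (Φ₀ X : ℂ)) Y).im / Θ₀ Y) ≤ ENNReal.ofReal (B * ρ /
      (‖latticeVec (2 * Real.pi / L) n‖ ^ 2) ^ 2))
    (hconvAll : ∀ v : ℝ → ℝ≥0∞, IsRepulsiveFiniteRange v → ∃ ρ₅ : ℝ, 0 < ρ₅ ∧ ∀ ρ : ℝ, 0 < ρ → ρ <
      ρ₅ → ∀ᶠ N : ℕ in atTop, 2 * periodicGroundStateEnergy v (N + 1) (sideLength ρ (N + 1)) ≤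
      periodicGroundStateEnergy v (N + 2) (sideLength ρ (N + 1)) + periodicGroundStateEnergy v N
      (sideLength ρ (N + 1)) + ENNReal.ofReal (Real.sqrt (ρ * (scatteringLength v).toReal) /
      sideLength ρ (N + 1)))
    (hK1 : StaticResponseBound) (v : ℝ → ℝ≥0∞) (hv : IsRepulsiveFiniteRange v)
    (hbdd : ∃ C : ℝ≥0, ∀ r, v r ≤ C) :
    ∃ ρ₀ : ℝ, 0 < ρ₀ ∧ ∀ ρ : ℝ, 0 < ρ → ρ < ρ₀ → ∃ c : ℝ, 0 < c ∧ ∀ᶠ N : ℕ in atTop,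
      ∃ δ : ℝ≥0∞, 0 < δ ∧ ∀ Ψ : PeriodicTrialState N (sideLength ρ N),
        periodicEnergy v Ψ ≤ periodicGroundStateEnergy v N (sideLength ρ N) + δ →
        ENNReal.ofReal (c * N) ≤ condensateOccupation N (sideLength ρ N) Ψ.ψ := by
  obtain ⟨ρA, hρA, hF⟩ := f0Floor_of_remainderDomination hR hconvAll hK1 v hv hbdd
  obtain ⟨ρB, hρB, hGS⟩ := groundStateFrame v hv hbdd
  refine ⟨min ρA ρB, lt_min hρA hρB, fun ρ hρ hρlt => ?_⟩
  have hρA' : ρ < ρA := lt_of_lt_of_le hρlt (min_le_left _ _)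
  have hρB' : ρ < ρB := lt_of_lt_of_le hρlt (min_le_right _ _)
  obtain ⟨c₁, hc₁, hFc⟩ := hF ρ hρ hρA'
  refine ⟨c₁ / 2, by positivity, ?_⟩
  -- the data live at particle number `N + 1`; prove the claim there and shift the index at the end
  refine eventually_atTop_of_eventually_succ (P := fun M => ∃ δ : ℝ≥0∞, 0 < δ ∧
    ∀ Ψ : PeriodicTrialState M (sideLength ρ M),
      periodicEnergy v Ψ ≤ periodicGroundStateEnergy v M (sideLength ρ M) + δ →
      ENNReal.ofReal (c₁ / 2 * M) ≤ condensateOccupation M (sideLength ρ M) Ψ.ψ) ?_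
  obtain ⟨R₀, hR₀⟩ := hv.2
  obtain ⟨Cv, hCv⟩ := hbdd
  filter_upwards [hFc, hGS ρ hρ hρB'] with N hFN hGSN
  set L : ℝ := sideLength ρ (N + 1) with hL_def
  have hL : 0 < L := sideLength_succ_pos hρ N
  obtain ⟨hb, ⟨hΘ, hΘc, hΘp⟩, ⟨hΦ, hΦc, hΦp⟩, Θ, Φ, -, hΦψ, -, hEΦ, -, -⟩ := hGSN
  set Θ₀ : Config N → ℝ := periodicFKGroundState v N L with hΘ₀_def
  set Φ₀ : Config (N + 1) → ℝ := periodicFKGroundState v (N + 1) L with hΦ₀_def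
  -- the floor on the exact ground state: `c₁ ≤ f₀(Φ₀)`, i.e. `c₁ (N+1) ≤ n₀(Φ₀)`
  have hf₀ : ENNReal.ofReal c₁ ≤ taggedZeroModeOccupation N L (fun X => (Φ₀ X : ℂ)) :=
    hFN L rfl hb Θ₀ hΘ hΘc hΘp Φ₀ hΦ hΦc hΦp
  have hcast : ENNReal.ofReal (((N + 1 : ℕ) : ℝ)) = (N + 1 : ℝ≥0∞) := by
    rw [ENNReal.ofReal_natCast]; push_cast; rfl
  have hn₀ : ENNReal.ofReal (c₁ * ((N + 1 : ℕ) : ℝ)) ≤ condensateOccupation (N + 1) L Φ.ψ := by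
    rw [hΦψ, ← succ_mul_taggedZeroModeOccupation hL, ENNReal.ofReal_mul hc₁.le, hcast, mul_comm]
    gcongr
  -- stability of `n₀` between `δ`-near-minimisers at `ε = c₁/2`
  obtain ⟨δ, hδ, hstab⟩ :=
    condensateOccupation_le_of_nearMinimisers hv.1 hR₀ hCv (N + 1) hL (ε := c₁ / 2) (by positivity)
  refine ⟨δ, hδ, fun Ψ hΨE => ?_⟩
  have hΦE : periodicEnergy v Φ ≤ periodicGroundStateEnergy v (N + 1) L + δ := hEΦ.le.trans le_self_add
  have htrans : ENNReal.ofReal (c₁ * ((N + 1 : ℕ) : ℝ)) ≤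
      condensateOccupation (N + 1) L Ψ.ψ + ENNReal.ofReal (c₁ / 2 * ((N + 1 : ℕ) : ℝ)) :=
    hn₀.trans (hstab Φ Ψ hΦE hΨE)
  have hsplit : ENNReal.ofReal (c₁ * ((N + 1 : ℕ) : ℝ)) =
      ENNReal.ofReal (c₁ / 2 * ((N + 1 : ℕ) : ℝ)) + ENNReal.ofReal (c₁ / 2 * ((N + 1 : ℕ) : ℝ)) := by
    rw [← ENNReal.ofReal_add (by positivity) (by positivity)]
    congr 1; ring
  rw [hsplit] at htrans
  exact (ENNReal.add_le_add_iff_right ENNReal.ofReal_ne_top).1 htrans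

end Summit.AtomisticToContinuum.BoseEinsteinCondensation.Theorems.CorrectorClosure.InsertionModeGaussianDomination

end
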